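import Mathlib
import HarnessLib
import Literature.Computability.AlgebraicComplexity.LaserMethodValuesSym
import Literature.Computability.AlgebraicComplexity.LaserComponentTools
import Literature.Computability.AlgebraicComplexity.AlmanLi2026SpectrumMatMul
import Summits.MatrixMultiplication.MatrixMultiplication.Theorems.OutsiderSandwichLaserBridge
import Summits.MatrixMultiplication.MatrixMultiplication.Theorems.OutsiderSandwichBlockItems
import Summits.MatrixMultiplication.MatrixMultiplication.Theorems.OutsiderSandwichBlockNormalForm

/-!
# OutsiderSandwich — `CouplingBenchmark` holds: `4 · F⟨2,2,2⟩² ≤ F(C)`; the door `R̃(C₁) ≤ 4 ⟹ ω = 2` is unconditional (decomp-mm lens-4, g17)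

Closes item 28538 `CouplingBenchmark` of `Theses/OutsiderSandwich.lean` (kernel Prop
`OutsiderSandwichBlock.CouplingBenchmark`): at every universal spectral point `F` over `ℂ`,
`4 · F⟨2,2,2⟩² ≤ F(C)` for the coupling tensor `C = C₁ ⊠ C₂ ⊠ C₃` of `cw₂ ⊗ cw₂`
(Coppersmith–Winograd 1990, §7: the value of the coupled term `T^{[211]}`, `V_τ³ ≥ 4 · (q²)^{3τ}` at
`q = 2`, read on the asymptotic spectrum).  Consequently the g17 DOOR is a theorem without
hypotheses: **`R̃(C₁) ≤ 4 ⟹ ω = 2`** (`summit_of_asymptoticRank_coupling₁_le_four`) — Strassen's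
asymptotic rank conjecture for the single explicit tight `4 × 4 × 4` tensor
`C₁ = (A; u, w) ↦ (A u, Aᵀ w)` (`OutsiderSandwichBlockNormalForm.pairTensor 2`) implies the summit.

## Proof

1. **Bridge** (`OutsiderSandwichLaserBridge.le_map_symm3_of_hasLaserValue`, general): a Le Gall value bound
   `V_ρ(t ⊗ t_C ⊗ t_{C²}) ≥ v` (`HasLaserValue`, tree `LaserValue.lean`) bounds every universal
   spectral point `G` with matrix exponent `ρ` (`G⟨M,M,M⟩ = M^ρ`) from below: `v ≤ G(t ⊗ t_C ⊗ t_{C²})`.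
   The symmetrisation is relabelled into the literally variable-symmetric CYCLIC CARRIER
   `cyc3 t (x,y,z) = t(x₁,y₂,z₃) t(y₁,z₂,x₃) t(z₁,x₂,y₃)`, the tree's cube extraction
   (`exists_polyDegeneratesTo_cube_of_hasLaserValue`, Alman 2021 Thm. 2.9 / Schönhage) turns the value
   into degenerations `cyc3(t)^{⊗N} ⊵ F ⊙ ⟨M,M,M⟩`, `u^N ≤ F M^ρ` (`u < v`), and `G` is monotone under
   degeneration (`ConverseDoorLimit.spectral_le_of_polyDegeneratesTo`) and multiplicative.
2. **Value** (`hasLaserValue_symm3_coupling₁`): the tree's laser method with values in Le Gall's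
   symmetrised form (`laserMethodSym_hasLaserValue`) on `C₁` with the Coppersmith–Winograd blocking
   `(x | y-halves | z-halves)`: block support `{(0,0,1),(0,1,0)}` (`≃ supp⟨1,2,1⟩`, tight via
   `α = (−1)`, `β = γ = (0,1)`), both components ARE `⟨2,1,2⟩` (`bench_component₀₀₁/₀₁₀`, from the
   normal form `OutsiderSandwichBlockNormalForm.coupling₁_apply_of_halves_*`), the uniform distribution
   has marginal entropies `0, 1, 1` and no penalty; value `2² · (4^{ρ/3})³ = 4 · 4^ρ`.
3. **Assembly** (`couplingBenchmark_holds`): `C₂ = C₁_{C²}`, `C₃ = C₁_C` (normal form), so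
   `F(C) = F(C₁ ⊗ C₁_C ⊗ C₁_{C²})`; with `ρ = θ₁+θ₂+θ₃` (`AlmanLi2026 … map_matMulTensor_cube`),
   `F⟨2,2,2⟩ = 2^ρ` and `4 · F⟨2,2,2⟩² = 4 · 4^ρ ≤ F(C)`.  Then `OutsiderSandwichBlock.summit_of_blockRankLeFour`
   and `R̃(rotate t) = R̃(t)` give the one-hypothesis door.
-/

noncomputable section

namespace Summit.MatrixMultiplication.MatrixMultiplication.Theorems.OutsiderSandwichCouplingBenchmark

open Literature.Computability.AlgebraicComplexity
open Summit.MatrixMultiplication.MatrixMultiplication.Theorems.OutsiderSandwichCoupling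
open Summit.MatrixMultiplication.MatrixMultiplication.Theorems.OutsiderSandwichBlockNormalForm
open Summit.MatrixMultiplication.MatrixMultiplication.Theorems.OutsiderSandwichLaserBridge

/-! ## 1. The Coppersmith–Winograd decomposition of `C₁` and its laser value -/

section Value

/-- The single block of the `x`-leg. -/
def blockX : Fin 4 → Fin 1 := fun _ => 0

/-- **`supp_D C₁ = {(0,0,1), (0,1,0)}`**: the `y`- and `z`-halves differ (`≃ supp⟨1,2,1⟩`). -/
def benchSupport : Finset (Fin 1 × Fin 2 × Fin 2) := {((0 : Fin 1), (0 : Fin 2), (1 : Fin 2)), (0, 1, 0)}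

/-- Membership in the support: the two halves differ. -/
private theorem mem_benchSupport_iff : ∀ s : Fin 1 × Fin 2 × Fin 2,
    s ∈ benchSupport ↔ s.2.1 ≠ s.2.2 := by
  decide

/-- The block support of `C₁` w.r.t. `(blockX, half, half)` is `benchSupport`. -/
theorem coupling₁_blockSupport (a b c : Fin 4) (h : coupling₁ a b c ≠ 0) :
    (blockX a, half b, half c) ∈ benchSupport := by
  rw [mem_benchSupport_iff]
  exact fun hbc => h (coupling₁_eq_zero_of_half_eq hbc)

/-- `half (decode⁻¹ (i, j)) = i`. -/
private theorem half_decode_symm (p : Fin 2 × Fin 2) : half (decode.symm p) = p.1 := by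
  have h := congrArg Prod.fst (decode.apply_symm_apply p)
  rwa [decode_apply] at h

/-- `pos (decode⁻¹ (i, j)) = j`. -/
private theorem pos_decode_symm (p : Fin 2 × Fin 2) : pos (decode.symm p) = p.2 := by
  have h := congrArg Prod.snd (decode.apply_symm_apply p)
  rwa [decode_apply] at h

/-- Entries of `C₁` on the block `(0,0,1)` in decoded coordinates: `A_{rc} · u_j · (Au)_i` is `1`
iff `j = c` and `i = r`. -/
private theorem coupling₁_decode_zero_one (r c j i : Fin 2) :
    coupling₁ (decode.symm (r, c)) (decode.symm (0, j)) (decode.symm (1, i)) =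
      if c = j ∧ r = i then 1 else 0 := by
  rw [coupling₁_apply_of_halves_zero_one (half_decode_symm _) (half_decode_symm _)]
  simp only [pos_decode_symm, half_decode_symm, xCol_eq_pos, xRow_eq_half]
  exact if_congr ⟨fun h => ⟨h.1.symm, h.2.symm⟩, fun h => ⟨h.1.symm, h.2.symm⟩⟩ rfl rfl

/-- Entries of `C₁` on the block `(0,1,0)`: `A_{rc} · w_j · (Aᵀw)_i` is `1` iff `j = r` and `i = c`. -/
private theorem coupling₁_decode_one_zero (r c j i : Fin 2) :
    coupling₁ (decode.symm (r, c)) (decode.symm (1, j)) (decode.symm (0, i)) =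
      if r = j ∧ c = i then 1 else 0 := by
  rw [coupling₁_apply_of_halves_one_zero (half_decode_symm _) (half_decode_symm _)]
  simp only [pos_decode_symm, half_decode_symm, xCol_eq_pos, xRow_eq_half]
  exact if_congr ⟨fun h => ⟨h.1.symm, h.2.symm⟩, fun h => ⟨h.1.symm, h.2.symm⟩⟩ rfl rfl

/-- **`C₁(0,0,1) ≃ ⟨2,1,2⟩`**: the component on `x × u × (Au)` (entries `A_{rc} u_c (Au)_r`)
restricts to `matMulTensor ℂ 2 1 2` (it is that tensor after relabelling). -/
theorem bench_component₀₀₁ :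
    TensorRestrictsTo (partSubtensor blockX half half coupling₁ {0} {0} {1})
      (matMulTensor ℂ 2 1 2) := by
  have e : (fun (u : Fin 2 × Fin 2) (v : Fin 2 × Fin 1) (w : Fin 1 × Fin 2) =>
      partSubtensor blockX half half coupling₁ {0} {0} {1} (decode.symm (u.2, u.1))
        (decode.symm (0, v.1)) (decode.symm (1, w.2))) = matMulTensor ℂ 2 1 2 := by
    funext u v w
    obtain ⟨u₁, u₂⟩ := u
    obtain ⟨v₁, v₂⟩ := v
    obtain ⟨w₁, w₂⟩ := w
    have hv₂ : v₂ = 0 := Subsingleton.elim _ _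
    have hw₁ : w₁ = 0 := Subsingleton.elim _ _
    subst hv₂ hw₁
    rw [partSubtensor_apply, if_pos, coupling₁_decode_zero_one]
    · by_cases h₁ : u₁ = v₁ <;> by_cases h₂ : u₂ = w₂ <;> simp [matMulTensor, h₁, h₂]
    · exact ⟨Finset.mem_singleton.2 rfl, Finset.mem_singleton.2 (half_decode_symm _),
        Finset.mem_singleton.2 (half_decode_symm _)⟩
  rw [← e]
  exact tensorRestrictsTo_precomp _ (fun u : Fin 2 × Fin 2 => decode.symm (u.2, u.1))
    (fun v : Fin 2 × Fin 1 => decode.symm (0, v.1)) (fun w : Fin 1 × Fin 2 => decode.symm (1, w.2))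

/-- **`C₁(0,1,0) ≃ ⟨2,1,2⟩`**: the component on `x × w × (Aᵀw)` (entries `A_{rc} w_r (Aᵀw)_c`)
restricts to `matMulTensor ℂ 2 1 2`. -/
theorem bench_component₀₁₀ :
    TensorRestrictsTo (partSubtensor blockX half half coupling₁ {0} {1} {0})
      (matMulTensor ℂ 2 1 2) := by
  have e : (fun (u : Fin 2 × Fin 2) (v : Fin 2 × Fin 1) (w : Fin 1 × Fin 2) =>
      partSubtensor blockX half half coupling₁ {0} {1} {0} (decode.symm u)
        (decode.symm (1, v.1)) (decode.symm (0, w.2))) = matMulTensor ℂ 2 1 2 := by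
    funext u v w
    obtain ⟨u₁, u₂⟩ := u
    obtain ⟨v₁, v₂⟩ := v
    obtain ⟨w₁, w₂⟩ := w
    have hv₂ : v₂ = 0 := Subsingleton.elim _ _
    have hw₁ : w₁ = 0 := Subsingleton.elim _ _
    subst hv₂ hw₁
    rw [partSubtensor_apply, if_pos, coupling₁_decode_one_zero]
    · by_cases h₁ : u₁ = v₁ <;> by_cases h₂ : u₂ = w₂ <;> simp [matMulTensor, h₁, h₂]
    · exact ⟨Finset.mem_singleton.2 rfl, Finset.mem_singleton.2 (half_decode_symm _),
        Finset.mem_singleton.2 (half_decode_symm _)⟩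
  rw [← e]
  exact tensorRestrictsTo_precomp _ (fun u : Fin 2 × Fin 2 => decode.symm u)
    (fun v : Fin 2 × Fin 1 => decode.symm (1, v.1)) (fun w : Fin 1 × Fin 2 => decode.symm (0, w.2))

/-- The uniform distribution on `supp_D C₁`. -/
def benchDist : Fin 1 × Fin 2 × Fin 2 → ℝ := fun s => if s.2.1 = s.2.2 then 0 else 1 / 2

/-- `P ≥ 0`. -/
private theorem benchDist_nonneg (s : Fin 1 × Fin 2 × Fin 2) : 0 ≤ benchDist s := by
  unfold benchDist
  split_ifs <;> norm_num

/-- `P` vanishes off the support. -/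
private theorem benchDist_eq_zero (s : Fin 1 × Fin 2 × Fin 2) (hs : s ∉ benchSupport) :
    benchDist s = 0 := by
  rw [mem_benchSupport_iff, not_not] at hs
  simp [benchDist, hs]

/-- `P = 1/2` on the support. -/
private theorem benchDist_of_mem (s : Fin 1 × Fin 2 × Fin 2) (hs : s ∈ benchSupport) :
    benchDist s = 1 / 2 := by
  rw [mem_benchSupport_iff] at hs
  simp [benchDist, hs]

/-- `∑ P = 1`. -/
private theorem sum_benchDist : ∑ s, benchDist s = 1 := by
  simp only [Fintype.sum_prod_type, Fin.sum_univ_two, Fin.sum_univ_one, benchDist]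
  norm_num

/-- `∑_S P = 1`. -/
private theorem sum_benchDist_support : ∑ s ∈ benchSupport, benchDist s = 1 := by
  rw [benchSupport, Finset.sum_pair (by decide)]
  simp only [benchDist]
  norm_num

/-- First marginal `(1)`. -/
private theorem marginalDist₁_benchDist : marginalDist₁ benchDist = fun _ => 1 := by
  funext a
  simp only [marginalDist₁, Fin.sum_univ_two, benchDist]
  norm_num

/-- Second marginal `(1/2, 1/2)`. -/
private theorem marginalDist₂_benchDist : marginalDist₂ benchDist = fun _ => 1 / 2 := by
  funext b
  simp only [marginalDist₂, Fin.sum_univ_two, Fin.sum_univ_one, benchDist]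
  fin_cases b <;> norm_num

/-- Third marginal `(1/2, 1/2)`. -/
private theorem marginalDist₃_benchDist : marginalDist₃ benchDist = fun _ => 1 / 2 := by
  funext c
  simp only [marginalDist₃, Fin.sum_univ_two, Fin.sum_univ_one, benchDist]
  fin_cases c <;> norm_num

/-- `H(1/2,1/2) = 1` bit (re-proved; the Strassen-template copy is private). -/
private theorem shannonEntropy_half_half : shannonEntropy (fun _ : Fin 2 => (1 / 2 : ℝ)) = 1 := by
  rw [shannonEntropy_def, Fin.sum_univ_two]
  have hl : Real.log 2 ≠ 0 := (Real.log_pos one_lt_two).ne'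
  have h : Real.negMulLog (1 / 2 : ℝ) = Real.log 2 / 2 := by
    rw [Real.negMulLog, one_div, Real.log_inv]
    ring
  rw [h]
  field_simp
  ring

/-- `H(1) = 0`. -/
private theorem shannonEntropy_point : shannonEntropy (fun _ : Fin 1 => (1 : ℝ)) = 0 := by
  rw [shannonEntropy_def, Fin.sum_univ_one, Real.negMulLog_one, zero_div]

/-- No penalty: `P` has product form `1 · (1/2) · 1` on the support. -/
private theorem maxEntropyPenalty_benchDist : maxEntropyPenalty benchSupport benchDist = 0 :=
  maxEntropyPenalty_eq_zero_of_mul benchSupport ⟨benchDist_nonneg, sum_benchDist⟩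
    benchDist_eq_zero (fun _ => 1) (fun _ => 1 / 2) (fun _ => 1) (fun _ _ => one_pos)
    (fun _ _ => by norm_num) (fun _ _ => one_pos)
    (fun s hs => by rw [benchDist_of_mem s hs]; ring)

/-- **The laser value of the coupled block** (Coppersmith–Winograd 1990, §7, the term `[211]` at
`q = 2`; in Le Gall's symmetrised form): `V_ρ(C₁ ⊗ C₁_C ⊗ C₁_{C²}) ≥ 4 · 4^ρ` for every `ρ`. -/
theorem hasLaserValue_symm3_coupling₁ (ρ : ℝ) : HasLaserValue ρ (symm3 coupling₁) (4 * 4 ^ ρ) := by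
  classical
  -- tightness data: `α = (-1)`, `β = γ = (0, 1)` (one integer coordinate, bound `1`)
  set α : Fin 1 → Fin 1 → ℤ := fun _ _ => -1 with hα
  set β : Fin 2 → Fin 1 → ℤ := fun j _ => (j : ℕ) with hβ
  have hαi : Function.Injective α := fun _ _ _ => Subsingleton.elim _ _
  have hβi : Function.Injective β := by
    intro j j' h
    have := congrFun h 0
    simp only [hβ] at this
    exact Fin.ext (by exact_mod_cast this)
  have hαb : ∀ i k, |α i k| ≤ 1 := by intro i k; simp [hα]
  have hβb : ∀ j k, |β j k| ≤ 1 := by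
    intro j k
    simp only [hβ]
    have := j.isLt
    rw [abs_le]
    constructor <;> omega
  have htight : ∀ s ∈ benchSupport, ∀ k, α s.1 k + β s.2.1 k + β s.2.2 k = 0 := by
    intro s hs k
    simp only [benchSupport, Finset.mem_insert, Finset.mem_singleton] at hs
    rcases hs with rfl | rfl <;> simp [hα, hβ]
  -- values of the components: both are `⟨2,1,2⟩`, volume `4`
  have h4 : (0 : ℝ) < 4 := by norm_num
  set u : Fin 1 × Fin 2 × Fin 2 → ℝ := fun _ => (4 : ℝ) ^ (ρ / 3) with hu
  have hu0 : ∀ s ∈ benchSupport, 0 < u s := fun s _ => Real.rpow_pos_of_pos h4 _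
  have hval : ∀ s ∈ benchSupport, HasLaserValue ρ
      (symm3 (partSubtensor blockX half half coupling₁ {s.1} {s.2.1} {s.2.2})) (u s ^ 3) := by
    intro s hs
    have h := hasLaserValue_symm3_matMulTensor ℂ ρ 2 1 2
    rw [show ((2 * 1 * 2 : ℕ) : ℝ) = 4 by norm_num] at h
    simp only [benchSupport, Finset.mem_insert, Finset.mem_singleton] at hs
    rcases hs with rfl | rfl
    · exact h.of_restrictsTo bench_component₀₀₁.symm3
    · exact h.of_restrictsTo bench_component₀₁₀.symm3
  have hH : shannonEntropy (marginalDist₁ benchDist) + shannonEntropy (marginalDist₂ benchDist) +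
      shannonEntropy (marginalDist₃ benchDist) - 3 * maxEntropyPenalty benchSupport benchDist
      = 2 := by
    rw [marginalDist₁_benchDist, marginalDist₂_benchDist, marginalDist₃_benchDist,
      shannonEntropy_half_half, shannonEntropy_point, maxEntropyPenalty_benchDist]
    norm_num
  have hprod : (∏ s ∈ benchSupport, u s ^ benchDist s) = (4 : ℝ) ^ (ρ / 3) := by
    simp only [hu]
    rw [← Real.rpow_sum_of_pos (Real.rpow_pos_of_pos h4 _) benchDist benchSupport,
      sum_benchDist_support, Real.rpow_one]
  have hrhs : (2 : ℝ) ^ (shannonEntropy (marginalDist₁ benchDist) +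
      shannonEntropy (marginalDist₂ benchDist) + shannonEntropy (marginalDist₃ benchDist) -
      3 * maxEntropyPenalty benchSupport benchDist) *
      (∏ s ∈ benchSupport, u s ^ benchDist s) ^ 3 = 4 * (4 : ℝ) ^ ρ := by
    rw [hH, hprod, ← Real.rpow_natCast ((4 : ℝ) ^ (ρ / 3)) 3, ← Real.rpow_mul h4.le]
    norm_num
  have h := laserMethodSym_hasLaserValue coupling₁ blockX half half benchSupport
    coupling₁_blockSupport α β β hαi hβi hβi hαb hβb hβb htight u hu0 hval benchDist
    benchDist_nonneg sum_benchDist benchDist_eq_zero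
  rwa [hrhs] at h

end Value


/-! ## 2. `CouplingBenchmark` and the unconditional door -/

section Assembly

/-- `C₃ = C₁_C` (`rotate`). -/
theorem coupling₃_eq_rotate : coupling₃ = rotate coupling₁ := by
  funext a b c
  exact coupling₃_eq_coupling₁ a b c

/-- `C₂ = C₁_{C²}`. -/
theorem coupling₂_eq_rotate_rotate : coupling₂ = rotate (rotate coupling₁) := by
  funext a b c
  exact coupling₂_eq_coupling₁ a b c

/-- `F(C) = F(C₁ ⊗ C₁_C ⊗ C₁_{C²})` at every universal spectral point. -/
theorem map_couplingTensor_eq_map_symm3 {F : SpectralMap ℂ} (hF : IsUniversalSpectralPoint ℂ F) :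
    F couplingTensor = F (symm3 coupling₁) := by
  rw [couplingTensor, hF.map_kronecker, hF.map_kronecker, symm3, hF.map_kronecker, hF.map_kronecker,
    coupling₃_eq_rotate, coupling₂_eq_rotate_rotate]
  ring

/-- **CouplingBenchmark holds**: `4 · F⟨2,2,2⟩² ≤ F(C)` at every universal spectral point `F` over `ℂ`
(Coppersmith–Winograd's value bound for the coupled term of `cw₂^{⊗2}`, `V(T^{[211]})³ ≥ 4 · (2²)^{3τ}`,
read on the asymptotic spectrum). -/
theorem couplingBenchmark_holds : OutsiderSandwichBlock.CouplingBenchmark := by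
  intro G hG
  set ρ : ℝ := ∑ i, specMMPoint ℂ G i with hρ
  have hcube : ∀ M : ℕ, 1 ≤ M → G (matMulTensor ℂ M M M) = (M : ℝ) ^ ρ := fun M hM =>
    hG.map_matMulTensor_cube hM
  have h2 : G (matMulTensor ℂ 2 2 2) = (2 : ℝ) ^ ρ := by exact_mod_cast hcube 2 (by norm_num)
  have h4 : (4 : ℝ) ≤ G (matMulTensor ℂ 2 2 2) := OutsiderSandwichEdgeRigidity.four_le_map_matMulTensor_two hG
  have hρ0 : 0 < ρ := by
    by_contra hle
    push Not at hle
    have : (2 : ℝ) ^ ρ ≤ 2 ^ (0 : ℝ) := Real.rpow_le_rpow_of_exponent_le one_le_two hle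
    rw [Real.rpow_zero, ← h2] at this
    linarith
  have hv := le_map_symm3_of_hasLaserValue coupling₁ hG hρ0 hcube (hasLaserValue_symm3_coupling₁ ρ)
  rw [map_couplingTensor_eq_map_symm3 hG, h2, ← Real.rpow_natCast ((2 : ℝ) ^ ρ) 2,
    ← Real.rpow_mul zero_le_two, mul_comm ρ, Real.rpow_mul zero_le_two]
  norm_num
  exact hv

/-- **Item 28538 `CouplingBenchmark` of `Theses/OutsiderSandwich.lean`, by name.** -/
theorem couplingBenchmark_item : Theses.OutsiderSandwich.CouplingBenchmark :=
  OutsiderSandwichBlockItems.couplingBenchmark_iff.2 couplingBenchmark_holds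

/-- **The door, unconditional**: `R̃(C_k) ≤ 4` (`k = 1,2,3`) implies `ω = 2`. -/
theorem summit_of_blockRankLeFour (h : OutsiderSandwichBlock.BlockRankLeFour) : _root_.MatrixMultiplication :=
  OutsiderSandwichBlock.summit_of_blockRankLeFour couplingBenchmark_holds h

end Assembly

/-! ## 3. The one-hypothesis door: `R̃(C₁) ≤ 4 ⟹ ω = 2` -/

section Door

/-- `R̃(C₃) = R̃(C₁)`. -/
theorem asymptoticRank_coupling₃ : asymptoticRank coupling₃ = asymptoticRank coupling₁ := by
  rw [coupling₃_eq_rotate, asymptoticRank_rotate]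

/-- `R̃(C₂) = R̃(C₁)`. -/
theorem asymptoticRank_coupling₂ : asymptoticRank coupling₂ = asymptoticRank coupling₁ := by
  rw [coupling₂_eq_rotate_rotate, asymptoticRank_rotate, asymptoticRank_rotate]

/-- **The g17 door, unconditional and with one hypothesis**: Strassen's asymptotic rank conjecture
for the single tight `4 × 4 × 4` tensor `C₁ = (A; u, w) ↦ (A u, Aᵀ w)` — `R̃(C₁) ≤ 4` — implies
`ω = 2`. -/
theorem summit_of_asymptoticRank_coupling₁_le_four (h : asymptoticRank coupling₁ ≤ 4) :
    _root_.MatrixMultiplication :=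
  summit_of_blockRankLeFour ⟨h, asymptoticRank_coupling₂.trans_le h, asymptoticRank_coupling₃.trans_le h⟩

/-- Contrapositive (the minimal-counterexample reading): if `ω > 2` then the explicit tensor
`C₁ = (A; u, w) ↦ (A u, Aᵀ w)` violates the asymptotic rank conjecture, `R̃(C₁) > 4`. -/
theorem four_lt_asymptoticRank_coupling₁_of_not_summit (h : ¬ _root_.MatrixMultiplication) :
    4 < asymptoticRank coupling₁ :=
  lt_of_not_ge fun h' => h (summit_of_asymptoticRank_coupling₁_le_four h')

end Door

end Summit.MatrixMultiplication.MatrixMultiplication.Theorems.OutsiderSandwichCouplingBenchmark
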